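import Mathlib
import Literature.MathematicalPhysics.QuantumFieldTheory.Balaban1983to89.Beta.LimitRate
import Literature.MathematicalPhysics.QuantumFieldTheory.Balaban1983to89.Beta.VolumeConvolution

/-!
# `Balaban1983to89.T4RateAlgebra` — T4-DAG row T4-U1.S (U1 ⟷ BETA liaison): the ONE unit-lattice η-rate statement that
serves both the T4 node U1 (NE2 at the unit scale, `T4EtaRate.EtaRateIneqUnit` / `NE2PlusUnit`) and the β sub-cell rows
an1–an3/an5 (`Beta.LimitRate.UniformDecay` + `StepRate`), made kernel-precise as a RATE PAIR, together with its closure algebra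

HONEST FRAMING (cell, verbatim from `HOME/t4/T4-DAG.md`): T4 is OPEN. The deliverables are: located quotations, a uniformity
census, typed hypothesis shapes, estimate sketches with every non-printed step flagged, and kernel-checked bookkeeping lemmas.
None of this is summit progress.  THIS MODULE ASSERTS NOTHING about Bałaban's or King's kernels: it is elementary real analysis
on `ℤ^d` ([folklore]) over the (5.10)-decay predicate `B12Sec2to5.Decay510` and pv04-g3's `Beta.latticeConv`.

ABSOLUTE RULE (cell, verbatim): No internally-minted statement may enter as a cited fact. Every hypothesis is either
kernel-proved in this package or a verbatim quotation of a PUBLISHED theorem with page reference. The manuscript(s) under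
audit are NOT citable for their own disputed steps — they are the thing under adjudication; programme-internal
(2001/route/tribunal) claims are never citable.

## The shared statement (liaison record `HOME/t4/T4-LIAISON-U1.md`)

Both consumers need, for a scale-indexed family `X_k : ℤ^d → ℝ` of UNIT-LATTICE kernels (T4: the unit-lattice covariances
`C^{(k)}(Λ_k)`, the kernels of `H_k`, `Δ_k`, `(Q G_k Q*)⁻¹` restricted to the unit lattice, read translation-invariantly at
background `U = 1`; BETA: the one-loop polarization kernels `Π⁰_{k+1,μν}` of [Balaban1987RG1] (1.22)), the PAIR

* (UD)  `|X_k(x)| ≤ C e^{−δ|x|₁}` uniformly in `k`                       — `RatePair.decay` = `Beta.LimitRate.UniformDecay`;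
* (PR′) `|X_{k+1}(x) − X_k(x)| ≤ C′θ^k e^{−δ|x|₁}`, `0 ≤ θ < 1`           — `RatePair.rate`  = `Beta.LimitRate.StepRate`
                                                                          = `T4EtaRate.EtaRateIneqUnit` read at `U = 1`,
                                                                            `inΛ := True`, `unitDist y y' := |y − y'|₁`
                                                                            (`unitStepIneq_iff`, §4).

(PR′) is NOT PRINTED for Bałaban's kernels (cell GAPS G-beta-10, G-t4-U1a-1..4); its printed A = 0 sibling is King's
Lemma 4.5 (4.38) p. 674, *"|C^{(k)}(x, y) − C^{(k+n)}(x, y)| ≤ CL^{−k}e^{−δ₀|x−y|}"* (θ = L^{−1}; render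
`HOME/b2b-balaban-template/king-renders/1986-cmp102-king-u1-higgs-I-p026-x2.png` read as an image by this lineage).

## What the algebra buys (§2): the pair is CLOSED under the operations by which composite kernels are built from primitive ones —
finite sums, scalar multiples, negation/difference, reflection `x ↦ −x`, POINTWISE PRODUCTS (position-space bubble kernels
`x ↦ Γ₁(x)Γ₂(±x)`) and `ℤ^d` CONVOLUTION (kernels of operator products; via `Beta.decay510_latticeConv`, rate `δ ↦ δ/2`).
Hence: whoever proves (UD)+(PR′) for the few PRIMITIVE unit-lattice kernels (the located missing estimate — T4 node U1 at the
unit scale / BETA rows an1–an2) gets (UD)+(PR′) for every kernel assembled from them by these operations, in particular — GIVEN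
a one-loop dictionary exhibiting `Π⁰_{k+1}` as such an assembly (row an1's business; NOT posited here) — the hypotheses of
`Beta.LimitRate.KernelInputs.ofStepRate` / `limitSplit_of_stepRate` (§3), i.e. the `hconv` input of the β flow theorems; and
T4 node U3 (NE5, Lipschitz dependence of the one-step objects on the linear objects) gets the same algebra for its linear layer.

## What is NOT here: no statement that any specific kernel of the series satisfies a `RatePair`; no one-loop formula; no
background fields (the with-background / Dirichlet-data version of (PR′) is `T4EtaRate.NE2PlusUnit`, a hypothesis shape).
Value = typed shared hypothesis + kernel closure lemmas + non-vacuity witness, NOT summit progress.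
-/

namespace Literature.MathematicalPhysics.QuantumFieldTheory.Balaban1983to89.T4RateAlgebra

open Literature.MathematicalPhysics.QuantumFieldTheory.Balaban1983to89.B12Sec2to5 (l1 l1_nonneg Decay510
  summable_exp_neg_l1 betaPrime510)
open Literature.MathematicalPhysics.QuantumFieldTheory.Balaban1983to89.Beta (latticeConv decay510_latticeConv decay510_mul
  decay510_mono decay510_reflect summable_latticeConv_term decay510_constant_nonneg)

noncomputable section

variable {d : ℕ}

/-! ## §1. Rate pairs -/

/-- The one-step (scale-to-scale) difference `X_{k+1} − X_k` of a scale-indexed family of `ℤ^d` kernels. [folklore] -/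
def step (X : ℕ → (Fin d → ℤ) → ℝ) (k : ℕ) : (Fin d → ℤ) → ℝ := fun x => X (k + 1) x - X k x

/-- Pointwise evaluation of the one-step difference. [folklore] -/
@[simp] theorem step_apply (X : ℕ → (Fin d → ℤ) → ℝ) (k : ℕ) (x : Fin d → ℤ) :
    step X k x = X (k + 1) x - X k x := rfl

/-- **RATE PAIR** — the shared unit-lattice η-rate hypothesis of T4 node U1 and BETA rows an1–an3/an5 for ONE scalar family
`X_k : ℤ^d → ℝ`: (UD) `|X_k(x)| ≤ C e^{−δ|x|₁}` uniformly in k, and (PR′) `|X_{k+1}(x) − X_k(x)| ≤ C′θ^k e^{−δ|x|₁}`.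
A PREDICATE (hypothesis shape); (PR′) is NOT PRINTED for the kernels of the series under audit — King's (4.38) is the printed
A = 0 sibling. [cite: King1986, Lemma 4.5 (4.38) p.674] -/
structure RatePair (X : ℕ → (Fin d → ℤ) → ℝ) (C δ C' θ : ℝ) : Prop where
  /-- (UD): k-uniform (5.10)-type decay. -/
  decay : ∀ k, Decay510 (X k) C δ
  /-- (PR′): one-step bound with the geometric factor `θ^k`. -/
  rate : ∀ k, Decay510 (step X k) (C' * θ ^ k) δ

/-- Transport of a (5.10)-bound along a pointwise equality of kernels and an equality of constants. [folklore] -/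
theorem decay510_congr {f g : (Fin d → ℤ) → ℝ} {A B δ : ℝ} (hf : Decay510 f A δ) (hg : ∀ x, g x = f x) (hAB : A = B) :
    Decay510 g B δ := by
  intro x
  rw [hg x, ← hAB]
  exact hf x

/-- (5.10)-bounds add: `|f + g| ≤ (A + B)e^{−δ|x|₁}`. [folklore] -/
theorem decay510_add {f g h : (Fin d → ℤ) → ℝ} {A B δ : ℝ} (hf : Decay510 f A δ) (hg : Decay510 g B δ)
    (hh : ∀ x, h x = f x + g x) : Decay510 h (A + B) δ := by
  intro x
  rw [hh x]
  calc |f x + g x| ≤ |f x| + |g x| := abs_add_le _ _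
    _ ≤ A * Real.exp (-δ * l1 x) + B * Real.exp (-δ * l1 x) := add_le_add (hf x) (hg x)
    _ = (A + B) * Real.exp (-δ * l1 x) := by ring

/-- (5.10)-bound of a scalar multiple. [folklore] -/
theorem decay510_smul {f : (Fin d → ℤ) → ℝ} {A δ : ℝ} (hf : Decay510 f A δ) (a : ℝ) :
    Decay510 (fun x => a * f x) (|a| * A) δ := by
  intro x
  rw [abs_mul, mul_assoc]
  exact mul_le_mul_of_nonneg_left (hf x) (abs_nonneg a)

/-- (5.10)-bound of the negative. [folklore] -/
theorem decay510_neg {f : (Fin d → ℤ) → ℝ} {A δ : ℝ} (hf : Decay510 f A δ) : Decay510 (fun x => -f x) A δ := by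
  intro x
  rw [abs_neg]
  exact hf x

namespace RatePair

variable {X Y : ℕ → (Fin d → ℤ) → ℝ} {C C₁ C₂ C' C'₁ C'₂ δ δ' θ : ℝ}

/-- The (UD) constant of a rate pair is `≥ 0`. [folklore] -/
theorem const_nonneg (h : RatePair X C δ C' θ) : 0 ≤ C := decay510_constant_nonneg (h.decay 0)

/-- The (PR′) constant of a rate pair is `≥ 0` (scale `k = 0`). [folklore] -/
theorem rateConst_nonneg (h : RatePair X C δ C' θ) : 0 ≤ C' := by
  have := decay510_constant_nonneg (h.rate 0)
  simpa using this

/-- A rate pair transported along a pointwise equality of families. [folklore] -/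
theorem congr (h : RatePair X C δ C' θ) (hXY : ∀ k x, Y k x = X k x) : RatePair Y C δ C' θ where
  decay k := decay510_congr (h.decay k) (hXY k) rfl
  rate k := decay510_congr (h.rate k) (fun x => by simp only [step_apply, hXY]) rfl

/-- Weakening the decay rate: `δ′ ≤ δ`. [folklore] -/
theorem mono (h : RatePair X C δ C' θ) (hle : δ' ≤ δ) : RatePair X C δ' C' θ where
  decay k := decay510_mono (h.decay k) hle
  rate k := decay510_mono (h.rate k) hle

/-! ## §2. Closure algebra -/

/-- CLOSURE UNDER SUMS: constants add. [folklore] -/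
theorem add (hX : RatePair X C₁ δ C'₁ θ) (hY : RatePair Y C₂ δ C'₂ θ) :
    RatePair (fun k x => X k x + Y k x) (C₁ + C₂) δ (C'₁ + C'₂) θ where
  decay k := decay510_add (hX.decay k) (hY.decay k) fun _ => rfl
  rate k := decay510_congr (decay510_add (hX.rate k) (hY.rate k) fun _ => rfl)
    (fun x => by simp only [step_apply]; ring) (by ring)

/-- CLOSURE UNDER SCALAR MULTIPLES. [folklore] -/
theorem smul (hX : RatePair X C δ C' θ) (a : ℝ) :
    RatePair (fun k x => a * X k x) (|a| * C) δ (|a| * C') θ where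
  decay k := decay510_smul (hX.decay k) a
  rate k := decay510_congr (decay510_smul (hX.rate k) a) (fun x => by simp only [step_apply]; ring) (by ring)

/-- CLOSURE UNDER NEGATION. [folklore] -/
theorem neg (hX : RatePair X C δ C' θ) : RatePair (fun k x => -X k x) C δ C' θ where
  decay k := decay510_neg (hX.decay k)
  rate k := decay510_congr (decay510_neg (hX.rate k)) (fun x => by simp only [step_apply]; ring) rfl

/-- CLOSURE UNDER DIFFERENCES. [folklore] -/
theorem sub (hX : RatePair X C₁ δ C'₁ θ) (hY : RatePair Y C₂ δ C'₂ θ) :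
    RatePair (fun k x => X k x - Y k x) (C₁ + C₂) δ (C'₁ + C'₂) θ :=
  (hX.add hY.neg).congr fun k x => sub_eq_add_neg (X k x) (Y k x)

/-- CLOSURE UNDER THE REFLECTION `x ↦ −x` (`|−x|₁ = |x|₁`). [folklore] -/
theorem reflect (hX : RatePair X C δ C' θ) : RatePair (fun k x => X k (-x)) C δ C' θ where
  decay k := decay510_reflect (hX.decay k)
  rate k := decay510_congr (decay510_reflect (hX.rate k)) (fun _ => rfl) rfl

/-- CLOSURE UNDER POINTWISE PRODUCTS (position-space bubble kernels `x ↦ X_k(x)·Y_k(x)`): by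
`X′Y′ − XY = (X′ − X)Y′ + X(Y′ − Y)`, the (PR′) constant is `C′₁C₂ + C₁C′₂`; the decay `2δ` is weakened back to `δ`
(`0 ≤ δ`). [folklore] -/
theorem mul (hδ : 0 ≤ δ) (hX : RatePair X C₁ δ C'₁ θ) (hY : RatePair Y C₂ δ C'₂ θ) :
    RatePair (fun k x => X k x * Y k x) (C₁ * C₂) δ (C'₁ * C₂ + C₁ * C'₂) θ where
  decay k := decay510_mono (decay510_mul (hX.decay k) (hY.decay k)) (by linarith)
  rate k := by
    have h1 : Decay510 (fun x => step X k x * Y (k + 1) x) (C'₁ * θ ^ k * C₂) δ :=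
      decay510_mono (decay510_mul (hX.rate k) (hY.decay (k + 1))) (by linarith)
    have h2 : Decay510 (fun x => X k x * step Y k x) (C₁ * (C'₂ * θ ^ k)) δ :=
      decay510_mono (decay510_mul (hX.decay k) (hY.rate k)) (by linarith)
    exact decay510_congr (decay510_add h1 h2 fun _ => rfl) (fun x => by simp only [step_apply]; ring) (by ring)

/-- The one-step difference of a convolution splits as `(F′ − F) ⋆ V′ + F ⋆ (V′ − V)` (all four series summable).
[folklore] -/
theorem latticeConv_step {F F' V V' : (Fin d → ℤ) → ℝ} (y : Fin d → ℤ)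
    (h1 : Summable fun z => F' (y - z) * V' z) (h2 : Summable fun z => F (y - z) * V z)
    (h3 : Summable fun z => (F' (y - z) - F (y - z)) * V' z)
    (h4 : Summable fun z => F (y - z) * (V' z - V z)) :
    latticeConv F' V' y - latticeConv F V y =
      latticeConv (fun x => F' x - F x) V' y + latticeConv F (fun x => V' x - V x) y := by
  have e : (fun z => F' (y - z) * V' z - F (y - z) * V z) =
      fun z => (F' (y - z) - F (y - z)) * V' z + F (y - z) * (V' z - V z) := by
    funext z; ring
  calc latticeConv F' V' y - latticeConv F V y
      = ∑' z, (F' (y - z) * V' z - F (y - z) * V z) := (h1.tsum_sub h2).symm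
    _ = ∑' z, ((F' (y - z) - F (y - z)) * V' z + F (y - z) * (V' z - V z)) := by rw [e]
    _ = _ := h3.tsum_add h4

/-- The `ℓ¹` constant `S(δ) = Σ'_{z∈ℤ^d} e^{−(δ−δ/2)|z|₁}` of `Beta.decay510_latticeConv` at the half rate. [folklore] -/
def convConst (d : ℕ) (δ : ℝ) : ℝ := ∑' z : Fin d → ℤ, Real.exp (-(δ - δ / 2) * l1 z)

/-- CLOSURE UNDER `ℤ^d` CONVOLUTION (kernels of operator products): `(X ⋆ Y)_k := X_k ⋆ Y_k` is a rate pair with decay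
`δ/2`, (UD) constant `C₁C₂S(δ)` and (PR′) constant `(C′₁C₂ + C₁C′₂)S(δ)`, by `(X ⋆ Y)′ − X ⋆ Y = (X′ − X) ⋆ Y′ + X ⋆ (Y′ − Y)`
and `Beta.decay510_latticeConv` (pv04-g3) — `0 < δ`. [folklore] -/
theorem conv (hδ : 0 < δ) (hX : RatePair X C₁ δ C'₁ θ) (hY : RatePair Y C₂ δ C'₂ θ) :
    RatePair (fun k => latticeConv (X k) (Y k)) (C₁ * C₂ * convConst d δ) (δ / 2)
      ((C'₁ * C₂ + C₁ * C'₂) * convConst d δ) θ where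
  decay k := decay510_latticeConv (hX.decay k) (hY.decay k) (half_pos hδ).le (half_le_self hδ.le) (half_lt_self hδ)
  rate k := by
    have hd1 := decay510_latticeConv (hX.rate k) (hY.decay (k + 1)) (half_pos hδ).le (half_le_self hδ.le)
      (half_lt_self hδ)
    have hd2 := decay510_latticeConv (hX.decay k) (hY.rate k) (half_pos hδ).le (half_le_self hδ.le) (half_lt_self hδ)
    refine decay510_congr (decay510_add hd1 hd2 fun _ => rfl) (fun y => ?_) (by unfold convConst; ring)
    simp only [step]
    exact latticeConv_step y
      (summable_latticeConv_term (hX.decay (k + 1)) (hY.decay (k + 1)) hδ.le hδ y)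
      (summable_latticeConv_term (hX.decay k) (hY.decay k) hδ.le hδ y)
      (summable_latticeConv_term (hX.rate k) (hY.decay (k + 1)) hδ.le hδ y)
      (summable_latticeConv_term (hX.decay k) (hY.rate k) hδ.le hδ y)

end RatePair

/-! ## §3. BETA reading: a rate pair of the `(μ,ν)` components IS (UD) + (PR′) of `Beta.LimitRate`, and feeds `KernelInputs` -/

/-- DICTIONARY, β side (definitional): for a family of polarization kernels `P_k` on `ℤ^d`, `RatePair` of the `(μ,ν)`
component is literally `UniformDecay ∧ StepRate` of `Beta.LimitRate` (rows an1/an2's deliverable shape). [folklore] -/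
theorem ratePair_iff_uniformDecay_and_stepRate (P : ℕ → B12Beta.Kernel d) (μ ν : Fin d) (C δ C' θ : ℝ) :
    RatePair (fun k => P k μ ν) C δ C' θ ↔
      Beta.LimitRate.UniformDecay P μ ν C δ ∧ Beta.LimitRate.StepRate P μ ν C' δ θ :=
  ⟨fun h => ⟨h.decay, h.rate⟩, fun h => ⟨h.1, h.2⟩⟩

/-- … hence a rate pair of one off-diagonal component (`μ ≠ ν`, `0 < δ`, `0 ≤ θ < 1`) packages into the hypothesis
structure `Beta.LimitRate.KernelInputs` (limit kernel = the telescoped one, rate constant `C′/(1−θ)`).  A constructor of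
hypotheses; nothing asserted. [cite: Balaban1987RG1, (1.22) p.264] -/
def kernelInputsOfRatePair {P : ℕ → B12Beta.Kernel d} {μ ν : Fin d} (hne : μ ≠ ν) {C δ C' θ : ℝ}
    (hδ : 0 < δ) (hθ0 : 0 ≤ θ) (hθ1 : θ < 1) (h : RatePair (fun k => P k μ ν) C δ C' θ) :
    Beta.LimitRate.KernelInputs d P :=
  Beta.LimitRate.KernelInputs.ofStepRate hne hδ h.decay hδ hθ0 hθ1 h.rate

/-- … and over pv25's one-loop dictionary `Beta.OneLoopDictionary`: a rate pair of the `(μ,ν)` component of the limit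
kernels gives the geometric convergence of the one-loop coefficients, `|β⁰_{k+1} − β⁰_∞| ≤ β′(C′/(1−θ), δ)·θ^k` — the
`hconv` input of the β flow theorems (`Beta.LimitRate.limitSplit_of_stepRate`, row an5). [cite: Balaban1987RG1, (1.22) p.264] -/
theorem limitSplit_of_ratePair {c : ℕ} {β : (k : ℕ) → (Fin (k + 1) → ℝ) → ℝ} {S : B12Beta.OneLoopSplit β}
    (D : Beta.OneLoopDictionary d c S) {μ ν : Fin d} (hne : μ ≠ ν) {C δ C' θ : ℝ} (hδ : 0 < δ) (hθ0 : 0 ≤ θ)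
    (hθ1 : θ < 1) (h : RatePair (fun k => D.limKernel k μ ν) C δ C' θ) :
    ∀ k, |S.β0 k - (kernelInputsOfRatePair hne hδ hθ0 hθ1 h).binf| ≤ betaPrime510 d (C' / (1 - θ)) δ * θ ^ k :=
  Beta.LimitRate.limitSplit_of_stepRate D hne hδ h.decay hδ hθ0 hθ1 h.rate

/-! ## §4. T4 reading: (PR′) is `T4EtaRate.EtaRateIneqUnit` on the translation-invariant, no-background sub-family -/

/-- The T4 unit-lattice inequality shape `|K′(y,y′) − K(y,y′)| ≤ B₀e^{−δ₀·dist(y,y′)}θ^k` — literally the body of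
`T4EtaRate.EtaRateIneqUnit` with `inΛ := fun _ => True`, `unitDist y y' := |y − y′|₁` and the translation-invariant kernel
`(y, y′) ↦ X_k(y − y′)` at background `U = 1` (King's (4.38) is its printed A = 0 instance, θ = L⁻¹).  HYPOTHESIS SHAPE.
[cite: King1986, Lemma 4.5 (4.38) p.674] -/
def UnitStepIneq (X : ℕ → (Fin d → ℤ) → ℝ) (B₀ δ₀ θ : ℝ) : Prop :=
  ∀ (k : ℕ) (y y' : Fin d → ℤ),
    |X (k + 1) (y - y') - X k (y - y')| ≤ B₀ * Real.exp (-(δ₀ * l1 (y - y'))) * θ ^ k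

/-- DICTIONARY, T4 side: the T4 unit-lattice inequality for a translation-invariant family is EXACTLY the (PR′) clause of a
rate pair (evaluate at `y′ = 0`; conversely at `y − y′`). [folklore] -/
theorem unitStepIneq_iff (X : ℕ → (Fin d → ℤ) → ℝ) (B₀ δ₀ θ : ℝ) :
    UnitStepIneq X B₀ δ₀ θ ↔ ∀ k, Decay510 (step X k) (B₀ * θ ^ k) δ₀ := by
  constructor
  · intro h k x
    have hx := h k x 0
    simp only [sub_zero] at hx
    rw [step_apply, neg_mul]
    exact hx.trans (le_of_eq (by ring))
  · intro h k y y'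
    have hx := h k (y - y')
    rw [step_apply, neg_mul] at hx
    exact hx.trans (le_of_eq (by ring))

/-- … so (UD) + the T4 unit-lattice inequality give a rate pair. [folklore] -/
theorem ratePair_of_unitStepIneq {X : ℕ → (Fin d → ℤ) → ℝ} {C δ B₀ θ : ℝ} (hUD : ∀ k, Decay510 (X k) C δ)
    (hT4 : UnitStepIneq X B₀ δ θ) : RatePair X C δ B₀ θ :=
  ⟨hUD, (unitStepIneq_iff X B₀ δ θ).mp hT4⟩

/-! ## §5. Non-vacuity: a model rate pair -/

namespace Witness

/-- The model family `X_k(x) = (1 + 2^{−k})e^{−|x|₁}` on `ℤ^d`. [folklore] -/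
def X (d : ℕ) (k : ℕ) (x : Fin d → ℤ) : ℝ := (1 + (1 / 2 : ℝ) ^ k) * Real.exp (-1 * l1 x)

/-- The model family is a rate pair with `C = 2`, `δ = 1`, `C′ = θ = ½` (its one-step differences are
`−2^{−(k+1)}e^{−|x|₁}` exactly). [folklore] -/
theorem ratePair (d : ℕ) : RatePair (X d) 2 1 (1 / 2) (1 / 2) where
  decay k x := by
    have hp : (1 / 2 : ℝ) ^ k ≤ 1 := pow_le_one₀ (by norm_num) (by norm_num)
    have he : 0 < Real.exp (-1 * l1 x) := Real.exp_pos _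
    rw [X, abs_of_nonneg (by positivity)]
    nlinarith
  rate k x := by
    have he : 0 < Real.exp (-1 * l1 x) := Real.exp_pos _
    have e : step (X d) k x = -((1 / 2) * (1 / 2) ^ k * Real.exp (-1 * l1 x)) := by
      simp only [step_apply, X, pow_succ]; ring
    rw [e, abs_neg, abs_of_nonneg (by positivity)]

/-- NON-VACUITY of `RatePair` (and of every closure theorem of §2 applied to it). [folklore] -/
theorem ratePair_nonvacuous : ∃ (X : ℕ → (Fin 4 → ℤ) → ℝ) (C δ C' θ : ℝ), 0 < δ ∧ 0 ≤ θ ∧ θ < 1 ∧ RatePair X C δ C' θ :=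
  ⟨X 4, 2, 1, 1 / 2, 1 / 2, one_pos, by norm_num, by norm_num, ratePair 4⟩

end Witness

end

end Literature.MathematicalPhysics.QuantumFieldTheory.Balaban1983to89.T4RateAlgebra
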